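import Mathlib
import HarnessLib
import Summits.Ventures.LatticeQCDFlow.Scoring.KArmPooledAfterHomogeneity
import Summits.Ventures.LatticeQCDFlow.Scoring.GaussianNoncentralCochranIndependence
import Summits.Ventures.LatticeQCDFlow.Scoring.KArmHomogeneityLocalPower
import Summits.Ventures.LatticeQCDFlow.Scoring.GaussianShiftedBallThreshold

/-!
# POOLING UNDER LOCAL DRIFTS: THE POOLED ESTIMATE INHERITS THE WEIGHTED-MEAN DRIFT `h̄_w`, THE
# HOMOGENEITY TEST SEES ONLY THE DISPERSION `κ`, AND THE TWO STAY INDEPENDENT — SO A DRIFT COMMON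
# TO ALL CODES PASSES THE TEST AT THE NOMINAL RATE AND IS FULLY PRESENT IN THE POOLED INTERVAL

HONEST FRAMING: exact (Metropolis-corrected) sampling algorithms for lattice gauge theory;
figures of merit are autocorrelation/cost numbers at stated couplings and volumes; no
continuum-physics claim.

Venture `LatticeQCDFlow` (cell pub-lqcd), topic `Scoring`; FANOUT row 4 (`s0-u1-b`, GEN-35).
NEW WORK of the cell (classical large-sample statistics; our formalisation), no definition,
nothing cited as a fact.

WHY (row 4).  `Scoring/KArmPooledAfterHomogeneity` shows that with EQUAL targets "test, then pool"
is asymptotically safe.  The honest complement is what happens under the local alternatives of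
`Scoring/KArmHomogeneityLocalPower` (code `r` centred at `a + h_r/√k`): with `W = Σ_r s_r⁻¹`,
`h̄_w = (Σ_r h_r/s_r)/W` and `κ² = Σ_r (h_r − h̄_w)²/s_r`,
(i) the joint law of the two limit functionals is `N(h̄_w·√W, 1) ⊗ (shifted ball with κ)`
(**`measure_pooled_inter_homogeneity_shifted_eq`**, from `Scoring/GaussianNoncentralCochranIndependence`);
(ii) the pooled interval "`|m̂ₖ − a| ≤ z·√V̂ₖ^pool`" covers the NOMINAL target `a` with probability
`→ N(h̄_w·√W, 1)([−|z|,|z|])` (**`kArm_pooled_localDrift`**): the pooled estimate is centred at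
`a + h̄_w/√k`, i.e. it inherits exactly the inverse-variance weighted mean of the drifts;
(iii) jointly with the test: `P(cover ∧ Qₖ ≤ c) → N(h̄_w√W,1)([−|z|,|z|]) · F_c(κ)` and, for `c > 0`,
CONDITIONALLY on passing, the coverage still tends to `N(h̄_w√W,1)([−|z|,|z|])`
(**`kArm_pooled_homogeneity_localDrift`**, **`kArm_pooled_conditional_localDrift`**): selecting on
the homogeneity test neither removes nor changes the drift of the pooled estimate;
(iv) in particular under a drift COMMON to all codes (`h_r = d`): `κ = 0`, the test passes at its
nominal rate (`Scoring/KArmHomogeneityLocalPowerStrict`), while the pooled interval covers `a` with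
probability `→ N(d·√W, 1)([−|z|,|z|])` (**`kArm_pooled_commonDrift`**), which for `d ≠ 0`, `z ≠ 0`
is STRICTLY below the nominal `N(0,1)([−|z|,|z|])` and strictly DECREASING in the pooled precision
`W` (**`gaussianReal_real_Icc_symm_drift_lt`**, **`gaussianReal_real_Icc_symm_drift_strictAnti`**):
agreement followed by pooling cannot detect a shared bias, and pooling more (or more precise)
equally-biased codes makes the quoted interval miss MORE often.

NOT CLAIMED: anything at finite `k`; dependent codes; numbers.
-/

open MeasureTheory ProbabilityTheory Filter Topology Finset

namespace Summit.Ventures.LatticeQCDFlow.Scoring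

open Set WithLp

/-! ## §1 The joint law of the two limit functionals under drifts -/

section ShiftedLaw

variable {n : ℕ} {Ω' : Type*} [MeasurableSpace Ω'] {P' : Measure Ω'} [IsProbabilityMeasure P']

/-- **THE JOINT LAW UNDER DRIFTS FACTORISES**: independent `Z_r ∼ N(h_r, s_r)` (`s_r > 0`,
`R = n + 2`), Borel `A, B`; `W = Σ_r s_r⁻¹`, `h̄_w = (Σ_r h_r/s_r)/W`, `κ² = Σ_r (h_r − h̄_w)²/s_r`:
`P'({(Σ_r Z_r/s_r)/√W ∈ A} ∩ {Σ_r (Z_r − m̂(Z))²/s_r ∈ B})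
  = N(h̄_w·√W, 1)(A) · N(0,1)^{⊗R}{z | (z_1 + κ)² + Σ_{r≠0,1} z_r² ∈ B}`. [ours] -/
theorem measure_pooled_inter_homogeneity_shifted_eq {Z : Fin (n + 2) → Ω' → ℝ}
    {h s : Fin (n + 2) → ℝ} (hs : ∀ r, 0 < s r) (hZm : ∀ r, Measurable (Z r))
    (hZ : ∀ r, HasLaw (Z r) (gaussianReal (h r) (s r).toNNReal) P') (hind : iIndepFun Z P')
    {A B : Set ℝ} (hA : MeasurableSet A) (hB : MeasurableSet B) :
    P' ({ω' | (∑ j, Z j ω' / s j) / Real.sqrt (∑ j, (s j)⁻¹) ∈ A}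
        ∩ {ω' | ∑ r, (Z r ω' - (∑ j, Z j ω' / s j) / (∑ j, (s j)⁻¹)) ^ 2 / s r ∈ B})
      = gaussianReal ((∑ j, h j / s j) / (∑ j, (s j)⁻¹) * Real.sqrt (∑ j, (s j)⁻¹)) 1 A
        * (Measure.pi fun _ : Fin (n + 2) => gaussianReal 0 1)
          {z : Fin (n + 2) → ℝ | (z 1 + Real.sqrt (∑ r, (h r - (∑ j, h j / s j) / (∑ j, (s j)⁻¹)) ^ 2
            / s r)) ^ 2 + ∑ r ∈ (univ.erase 0).erase 1, z r ^ 2 ∈ B} := by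
  have hlaw := hasLaw_standardise_shift_pi hs hZm hZ hind
  set σ : Fin (n + 2) → ℝ := fun r => Real.sqrt (s r) with hσ
  have hσpos : ∀ r, 0 < σ r := fun r => Real.sqrt_pos.2 (hs r)
  have hσsq : ∀ r, σ r ^ 2 = s r := fun r => Real.sq_sqrt (hs r).le
  have hW : 0 < ∑ j, (s j)⁻¹ := Finset.sum_pos (fun j _ => inv_pos.2 (hs j)) Finset.univ_nonempty
  set C : Set (Fin (n + 2) → ℝ) :=
    {z | (∑ j, (h j + σ j * z j) / σ j ^ 2) / (∑ j, (σ j ^ 2)⁻¹) * Real.sqrt (∑ j, (σ j ^ 2)⁻¹) ∈ A}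
      ∩ {z | ∑ i, ((h i + σ i * z i) - (∑ j, (h j + σ j * z j) / σ j ^ 2) / (∑ j, (σ j ^ 2)⁻¹)) ^ 2
        / σ i ^ 2 ∈ B} with hC
  have hCm : MeasurableSet C := by
    simp only [hC]
    exact ((by fun_prop : Measurable fun z : Fin (n + 2) → ℝ =>
      (∑ j, (h j + σ j * z j) / σ j ^ 2) / (∑ j, (σ j ^ 2)⁻¹) * Real.sqrt (∑ j, (σ j ^ 2)⁻¹)) hA).inter
      ((by fun_prop : Measurable fun z : Fin (n + 2) → ℝ => ∑ i, ((h i + σ i * z i)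
        - (∑ j, (h j + σ j * z j) / σ j ^ 2) / (∑ j, (σ j ^ 2)⁻¹)) ^ 2 / σ i ^ 2) hB)
  have hsq : Real.sqrt (∑ j, (s j)⁻¹) ≠ 0 := (Real.sqrt_pos.2 hW).ne'
  have hpre : ({ω' | (∑ j, Z j ω' / s j) / Real.sqrt (∑ j, (s j)⁻¹) ∈ A}
        ∩ {ω' | ∑ r, (Z r ω' - (∑ j, Z j ω' / s j) / (∑ j, (s j)⁻¹)) ^ 2 / s r ∈ B})
      = (fun ω' (r : Fin (n + 2)) => (Z r ω' - h r) / Real.sqrt (s r)) ⁻¹' C := by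
    ext ω'
    simp only [hC, Set.mem_inter_iff, Set.mem_setOf_eq, Set.mem_preimage, hσsq]
    have hx : ∀ r, h r + σ r * ((Z r ω' - h r) / Real.sqrt (s r)) = Z r ω' := fun r => by
      have hsr : Real.sqrt (s r) ≠ 0 := (Real.sqrt_pos.2 (hs r)).ne'
      simp only [hσ]
      field_simp
      ring
    simp only [hx]
    have e : (∑ j, Z j ω' / s j) / (∑ j, (s j)⁻¹) * Real.sqrt (∑ j, (s j)⁻¹)
        = (∑ j, Z j ω' / s j) / Real.sqrt (∑ j, (s j)⁻¹) := by
      rw [div_mul_eq_mul_div, div_eq_div_iff hW.ne' hsq, mul_assoc, Real.mul_self_sqrt hW.le]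
    rw [e]
  rw [hpre, ← Measure.map_apply_of_aemeasurable hlaw.aemeasurable hCm, hlaw.map_eq, hC,
    pi_gaussianReal_pooled_inter_homogeneity_centres_eq_mul (zero_ne_one) h σ hσpos hA hB]
  simp only [hσsq]

/-- **The marginal of the pooled functional under drifts**: `P'((Σ_r Z_r/s_r)/√W ∈ A) = N(h̄_w·√W, 1)(A)`.
[ours] -/
theorem measure_pooled_shifted_preimage_eq {Z : Fin (n + 2) → Ω' → ℝ}
    {h s : Fin (n + 2) → ℝ} (hs : ∀ r, 0 < s r) (hZm : ∀ r, Measurable (Z r))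
    (hZ : ∀ r, HasLaw (Z r) (gaussianReal (h r) (s r).toNNReal) P') (hind : iIndepFun Z P')
    {A : Set ℝ} (hA : MeasurableSet A) :
    P' {ω' | (∑ j, Z j ω' / s j) / Real.sqrt (∑ j, (s j)⁻¹) ∈ A}
      = gaussianReal ((∑ j, h j / s j) / (∑ j, (s j)⁻¹) * Real.sqrt (∑ j, (s j)⁻¹)) 1 A := by
  have h1 := measure_pooled_inter_homogeneity_shifted_eq hs hZm hZ hind hA MeasurableSet.univ
  have e1 : {ω' | ∑ r, (Z r ω' - (∑ j, Z j ω' / s j) / (∑ j, (s j)⁻¹)) ^ 2 / s r ∈ (Set.univ : Set ℝ)}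
      = Set.univ := by ext; simp
  have e2 : {z : Fin (n + 2) → ℝ | (z 1 + Real.sqrt (∑ r, (h r - (∑ j, h j / s j) / (∑ j, (s j)⁻¹)) ^ 2
      / s r)) ^ 2 + ∑ r ∈ (univ.erase 0).erase 1, z r ^ 2 ∈ (Set.univ : Set ℝ)} = Set.univ := by
    ext; simp
  rw [e1, e2, Set.inter_univ, measure_univ, mul_one] at h1
  exact h1

/-- **The Gaussian product charges every shifted ball** `{(z_{r₁} + κ)² + Σ_{r≠r₀,r₁} z_r² ≤ c}`,
`c > 0`. [ours] -/
theorem pi_gaussianReal_shiftedBall_pos {ι : Type*} [Fintype ι] [DecidableEq ι] (r₀ r₁ : ι)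
    (κ : ℝ) {c : ℝ} (hc : 0 < c) :
    0 < (Measure.pi fun _ : ι => gaussianReal 0 1).real
      {z : ι → ℝ | (z r₁ + κ) ^ 2 + ∑ r ∈ (univ.erase r₀).erase r₁, z r ^ 2 ≤ c} := by
  haveI : ∀ _i : ι, (gaussianReal (0 : ℝ) 1).IsOpenPosMeasure := fun _ =>
    (gaussianReal_absolutelyContinuous' 0 one_ne_zero).isOpenPosMeasure
  have hopen : IsOpen {z : ι → ℝ | (z r₁ + κ) ^ 2 + ∑ r ∈ (univ.erase r₀).erase r₁, z r ^ 2 < c} :=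
    isOpen_lt (by fun_prop) continuous_const
  have hne : ({z : ι → ℝ | (z r₁ + κ) ^ 2 + ∑ r ∈ (univ.erase r₀).erase r₁, z r ^ 2 < c}).Nonempty := by
    refine ⟨fun r => if r = r₁ then -κ else 0, ?_⟩
    show ((if r₁ = r₁ then -κ else 0) + κ) ^ 2
      + ∑ r ∈ (univ.erase r₀).erase r₁, (if r = r₁ then -κ else 0) ^ 2 < c
    rw [if_pos rfl, neg_add_cancel, Finset.sum_eq_zero fun r hr => by
      rw [if_neg (Finset.mem_erase.1 hr).1]; ring]
    simpa using hc
  have hpos := hopen.measure_pos (Measure.pi fun _ : ι => gaussianReal 0 1) hne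
  rw [measureReal_def, ENNReal.toReal_pos_iff]
  refine ⟨hpos.trans_le (measure_mono fun z hz => ?_), measure_lt_top _ _⟩
  simp only [Set.mem_setOf_eq] at hz ⊢
  exact hz.le

end ShiftedLaw

/-! ## §2 The pooled interval, alone and jointly with the test, under drifts -/

section Drift

variable {n : ℕ} {Ωs : Fin (n + 2) → Type*} [∀ r, MeasurableSpace (Ωs r)]
  {Ps : (r : Fin (n + 2)) → Measure (Ωs r)} [∀ r, IsProbabilityMeasure (Ps r)]
variable {Ω' : Type*} [MeasurableSpace Ω'] {P' : Measure Ω'} [IsProbabilityMeasure P']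

/-- **THE POOLED INTERVAL UNDER LOCAL DRIFTS.**  `R = n + 2 ≥ 2` codes, `√k(Sₖ^r − a) ⇒ N(h_r, s_r)`
(`s_r > 0`, independent), `k·V̂ₖ^r → s_r` a.s.: for every `z`,
`P((m̂ₖ − a)²·Σ_r (V̂ₖ^r)⁻¹ ≤ z²) → N(h̄_w·√W, 1)([−|z|, |z|])`, `W = Σ_r s_r⁻¹`,
`h̄_w = (Σ_r h_r/s_r)/W` — the pooled estimate is centred at `a + h̄_w/√k`. [ours] -/
theorem kArm_pooled_localDrift {S V : (r : Fin (n + 2)) → ℕ → Ωs r → ℝ} {a : ℝ}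
    {h s : Fin (n + 2) → ℝ} {Z : Fin (n + 2) → Ω' → ℝ} (hs : ∀ r, 0 < s r)
    (hSm : ∀ r k, Measurable (S r k)) (hVm : ∀ r k, Measurable (V r k))
    (hclt : ∀ r, TendstoInDistribution (fun (k : ℕ) ω => Real.sqrt k * (S r k ω - a)) atTop (Z r)
      (fun _ => Ps r) P')
    (hZm : ∀ r, Measurable (Z r)) (hZ : ∀ r, HasLaw (Z r) (gaussianReal (h r) (s r).toNNReal) P')
    (hind : iIndepFun Z P')
    (hV : ∀ r, ∀ᵐ ω ∂(Ps r), Tendsto (fun k : ℕ => (k : ℝ) * V r k ω) atTop (𝓝 (s r))) (z : ℝ) :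
    Tendsto (fun k : ℕ => (Measure.pi Ps).real {ω : (r : Fin (n + 2)) → Ωs r |
        ((∑ j, S j k (ω j) / V j k (ω j)) / (∑ j, (V j k (ω j))⁻¹) - a) ^ 2 * (∑ j, (V j k (ω j))⁻¹)
          ≤ z ^ 2})
      atTop (𝓝 ((gaussianReal ((∑ j, h j / s j) / (∑ j, (s j)⁻¹) * Real.sqrt (∑ j, (s j)⁻¹)) 1).real
        (Icc (-|z|) |z|))) := by
  have hW : 0 < ∑ j, (s j)⁻¹ := Finset.sum_pos (fun j _ => inv_pos.2 (hs j)) Finset.univ_nonempty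
  set τ := (∑ j, h j / s j) / (∑ j, (s j)⁻¹) * Real.sqrt (∑ j, (s j)⁻¹) with hτ
  have hsqev : ∀ {T : Set ℝ}, MeasurableSet T →
      P' {ω' | (∑ j, Z j ω' / s j) ^ 2 / (∑ j, (s j)⁻¹) ∈ T} = gaussianReal τ 1 {t | t ^ 2 ∈ T} := by
    intro T hT
    have hT' : MeasurableSet {t : ℝ | t ^ 2 ∈ T} := (by fun_prop : Measurable fun t : ℝ => t ^ 2) hT
    have h1 := measure_pooled_shifted_preimage_eq hs hZm hZ hind hT'
    have e : {ω' | (∑ j, Z j ω' / s j) / Real.sqrt (∑ j, (s j)⁻¹) ∈ {t : ℝ | t ^ 2 ∈ T}}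
        = {ω' | (∑ j, Z j ω' / s j) ^ 2 / (∑ j, (s j)⁻¹) ∈ T} := by
      ext ω'
      simp only [Set.mem_setOf_eq, div_pow, Real.sq_sqrt hW.le]
    rw [e] at h1
    exact h1
  have hatom : P' {ω' | (∑ j, Z j ω' / s j) ^ 2 / (∑ j, (s j)⁻¹) = z ^ 2} = 0 := by
    have h1 := hsqev (measurableSet_singleton (z ^ 2))
    simp only [Set.mem_singleton_iff] at h1
    rw [h1]
    have hsub : {t : ℝ | t ^ 2 = z ^ 2} ⊆ {z, -z} := by
      intro t ht
      simp only [Set.mem_setOf_eq] at ht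
      rcases sq_eq_sq_iff_eq_or_eq_neg.1 ht with h2 | h2
      · simp [h2]
      · simp [h2]
    exact measure_mono_null hsub (by
      haveI := nullSingletonClass_gaussianReal (μ := τ) one_ne_zero
      exact (Set.toFinite _).measure_zero _)
  have hconv := kArm_pooled_limit hs hSm hVm hclt hZm hind hV hatom
  have hlimit : P'.real {ω' | (∑ j, Z j ω' / s j) ^ 2 / (∑ j, (s j)⁻¹) ≤ z ^ 2}
      = (gaussianReal τ 1).real (Icc (-|z|) |z|) := by
    simp only [measureReal_def]
    congr 1
    have h1 := hsqev (measurableSet_Iic (a := z ^ 2))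
    simp only [Set.mem_Iic] at h1
    rw [h1, setOf_sq_le_sq_eq_Icc]
  rw [hlimit] at hconv
  exact hconv

/-- **JOINTLY WITH THE TEST, UNDER DRIFTS**: same setting, every `z`, `c`:
`P((m̂ₖ − a)²·Σ_r (V̂ₖ^r)⁻¹ ≤ z² ∧ Qₖ ≤ c) → N(h̄_w√W, 1)([−|z|,|z|]) · F_c(κ)`, `F_c(κ)` the
shifted-ball probability of `Scoring/KArmHomogeneityLocalPower`. [ours] -/
theorem kArm_pooled_homogeneity_localDrift {S V : (r : Fin (n + 2)) → ℕ → Ωs r → ℝ} {a : ℝ}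
    {h s : Fin (n + 2) → ℝ} {Z : Fin (n + 2) → Ω' → ℝ} (hs : ∀ r, 0 < s r)
    (hSm : ∀ r k, Measurable (S r k)) (hVm : ∀ r k, Measurable (V r k))
    (hclt : ∀ r, TendstoInDistribution (fun (k : ℕ) ω => Real.sqrt k * (S r k ω - a)) atTop (Z r)
      (fun _ => Ps r) P')
    (hZm : ∀ r, Measurable (Z r)) (hZ : ∀ r, HasLaw (Z r) (gaussianReal (h r) (s r).toNNReal) P')
    (hind : iIndepFun Z P')
    (hV : ∀ r, ∀ᵐ ω ∂(Ps r), Tendsto (fun k : ℕ => (k : ℝ) * V r k ω) atTop (𝓝 (s r))) (z c : ℝ) :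
    Tendsto (fun k : ℕ => (Measure.pi Ps).real ({ω : (r : Fin (n + 2)) → Ωs r |
        ((∑ j, S j k (ω j) / V j k (ω j)) / (∑ j, (V j k (ω j))⁻¹) - a) ^ 2 * (∑ j, (V j k (ω j))⁻¹)
          ≤ z ^ 2} ∩ {ω | ∑ r, (S r k (ω r) - (∑ j, S j k (ω j) / V j k (ω j)) / (∑ j, (V j k (ω j))⁻¹)) ^ 2
          / V r k (ω r) ≤ c}))
      atTop (𝓝 ((gaussianReal ((∑ j, h j / s j) / (∑ j, (s j)⁻¹) * Real.sqrt (∑ j, (s j)⁻¹)) 1).real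
          (Icc (-|z|) |z|)
        * (Measure.pi fun _ : Fin (n + 2) => gaussianReal 0 1).real
          {x : Fin (n + 2) → ℝ | (x 1 + Real.sqrt (∑ r, (h r - (∑ j, h j / s j) / (∑ j, (s j)⁻¹)) ^ 2
            / s r)) ^ 2 + ∑ r ∈ (univ.erase 0).erase 1, x r ^ 2 ≤ c})) := by
  have hpair := kArm_pooled_homogeneity_joint_tendsto hs hSm hVm hclt hZm hind hV
  have hW : 0 < ∑ j, (s j)⁻¹ := Finset.sum_pos (fun j _ => inv_pos.2 (hs j)) Finset.univ_nonempty
  set τ := (∑ j, h j / s j) / (∑ j, (s j)⁻¹) * Real.sqrt (∑ j, (s j)⁻¹) with hτ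
  set L : Ω' → ℝ × ℝ := fun ω' => ((∑ j, Z j ω' / s j) ^ 2 / (∑ j, (s j)⁻¹),
    ∑ r, (Z r ω' - (∑ j, Z j ω' / s j) / (∑ j, (s j)⁻¹)) ^ 2 / s r) with hL
  have hLm : Measurable L := by
    simp only [hL]
    fun_prop
  have hjoint : ∀ {T B : Set ℝ}, MeasurableSet T → MeasurableSet B →
      P' ({ω' | (∑ j, Z j ω' / s j) ^ 2 / (∑ j, (s j)⁻¹) ∈ T}
        ∩ {ω' | ∑ r, (Z r ω' - (∑ j, Z j ω' / s j) / (∑ j, (s j)⁻¹)) ^ 2 / s r ∈ B})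
        = gaussianReal τ 1 {t | t ^ 2 ∈ T} * (Measure.pi fun _ : Fin (n + 2) => gaussianReal 0 1)
          {x : Fin (n + 2) → ℝ | (x 1 + Real.sqrt (∑ r, (h r - (∑ j, h j / s j) / (∑ j, (s j)⁻¹)) ^ 2
            / s r)) ^ 2 + ∑ r ∈ (univ.erase 0).erase 1, x r ^ 2 ∈ B} := by
    intro T B hT hB
    have hT' : MeasurableSet {t : ℝ | t ^ 2 ∈ T} := (by fun_prop : Measurable fun t : ℝ => t ^ 2) hT
    have h1 := measure_pooled_inter_homogeneity_shifted_eq hs hZm hZ hind hT' hB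
    have e : {ω' | (∑ j, Z j ω' / s j) / Real.sqrt (∑ j, (s j)⁻¹) ∈ {t : ℝ | t ^ 2 ∈ T}}
        = {ω' | (∑ j, Z j ω' / s j) ^ 2 / (∑ j, (s j)⁻¹) ∈ T} := by
      ext ω'
      simp only [Set.mem_setOf_eq, div_pow, Real.sq_sqrt hW.le]
    rw [e] at h1
    exact h1
  -- no atoms on the two level lines
  have h1 : P' {ω' | (∑ j, Z j ω' / s j) ^ 2 / (∑ j, (s j)⁻¹) = z ^ 2} = 0 := by
    have hh0 := hjoint (measurableSet_singleton (z ^ 2)) MeasurableSet.univ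
    have e1 : {ω' | ∑ r, (Z r ω' - (∑ j, Z j ω' / s j) / (∑ j, (s j)⁻¹)) ^ 2 / s r ∈ (Set.univ : Set ℝ)}
        = Set.univ := by ext; simp
    have e2 : {x : Fin (n + 2) → ℝ | (x 1 + Real.sqrt (∑ r, (h r - (∑ j, h j / s j) / (∑ j, (s j)⁻¹)) ^ 2
        / s r)) ^ 2 + ∑ r ∈ (univ.erase 0).erase 1, x r ^ 2 ∈ (Set.univ : Set ℝ)} = Set.univ := by
      ext; simp
    rw [e1, e2, Set.inter_univ, measure_univ, mul_one] at hh0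
    simp only [Set.mem_singleton_iff] at hh0
    rw [hh0]
    have hsub : {t : ℝ | t ^ 2 = z ^ 2} ⊆ {z, -z} := by
      intro t ht
      simp only [Set.mem_setOf_eq] at ht
      rcases sq_eq_sq_iff_eq_or_eq_neg.1 ht with h2 | h2
      · simp [h2]
      · simp [h2]
    exact measure_mono_null hsub (by
      haveI := nullSingletonClass_gaussianReal (μ := τ) one_ne_zero
      exact (Set.toFinite _).measure_zero _)
  have h2 : P' {ω' | ∑ r, (Z r ω' - (∑ j, Z j ω' / s j) / (∑ j, (s j)⁻¹)) ^ 2 / s r = c} = 0 :=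
    measure_homogeneity_shifted_levelSet_eq_zero hs hZm hZ hind c
  have hfr : (P'.map L) (frontier (Iic (z ^ 2) ×ˢ Iic c)) = 0 := by
    refine measure_mono_null (frontier_Iic_prod_Iic_subset (z ^ 2) c) ?_
    rw [Measure.map_apply hLm ((measurableSet_eq_fun measurable_fst measurable_const).union
      (measurableSet_eq_fun measurable_snd measurable_const))]
    exact measure_union_null h1 h2
  have hconv := tendsto_measureReal_preimage_of_tendstoInDistribution_prod hpair
    (measurableSet_Iic.prod measurableSet_Iic) hfr
  have hlimit : P'.real (L ⁻¹' (Iic (z ^ 2) ×ˢ Iic c))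
      = (gaussianReal τ 1).real (Icc (-|z|) |z|)
        * (Measure.pi fun _ : Fin (n + 2) => gaussianReal 0 1).real
          {x : Fin (n + 2) → ℝ | (x 1 + Real.sqrt (∑ r, (h r - (∑ j, h j / s j) / (∑ j, (s j)⁻¹)) ^ 2
            / s r)) ^ 2 + ∑ r ∈ (univ.erase 0).erase 1, x r ^ 2 ≤ c} := by
    have h := hjoint (measurableSet_Iic (a := z ^ 2)) (measurableSet_Iic (a := c))
    have e : L ⁻¹' (Iic (z ^ 2) ×ˢ Iic c)
        = {ω' | (∑ j, Z j ω' / s j) ^ 2 / (∑ j, (s j)⁻¹) ∈ Iic (z ^ 2)}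
          ∩ {ω' | ∑ r, (Z r ω' - (∑ j, Z j ω' / s j) / (∑ j, (s j)⁻¹)) ^ 2 / s r ∈ Iic c} := by
      ext ω'
      simp only [hL, Set.mem_preimage, Set.mem_prod, Set.mem_inter_iff, Set.mem_setOf_eq]
    rw [measureReal_def, e, h, ENNReal.toReal_mul, measureReal_def, measureReal_def]
    simp only [Set.mem_Iic, setOf_sq_le_sq_eq_Icc]
  rw [hlimit] at hconv
  exact hconv

/-- **CONDITIONALLY ON PASSING THE TEST, UNDER DRIFTS**: same setting, `c > 0`: the conditional
coverage probability of the pooled interval given `Qₖ ≤ c` tends to `N(h̄_w√W, 1)([−|z|,|z|])` — the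
same as unconditionally: selection on the homogeneity test does not touch the drift. [ours] -/
theorem kArm_pooled_conditional_localDrift {S V : (r : Fin (n + 2)) → ℕ → Ωs r → ℝ} {a : ℝ}
    {h s : Fin (n + 2) → ℝ} {Z : Fin (n + 2) → Ω' → ℝ} (hs : ∀ r, 0 < s r)
    (hSm : ∀ r k, Measurable (S r k)) (hVm : ∀ r k, Measurable (V r k))
    (hclt : ∀ r, TendstoInDistribution (fun (k : ℕ) ω => Real.sqrt k * (S r k ω - a)) atTop (Z r)
      (fun _ => Ps r) P')
    (hZm : ∀ r, Measurable (Z r)) (hZ : ∀ r, HasLaw (Z r) (gaussianReal (h r) (s r).toNNReal) P')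
    (hind : iIndepFun Z P')
    (hV : ∀ r, ∀ᵐ ω ∂(Ps r), Tendsto (fun k : ℕ => (k : ℝ) * V r k ω) atTop (𝓝 (s r))) (z : ℝ)
    {c : ℝ} (hc : 0 < c) :
    Tendsto (fun k : ℕ => (Measure.pi Ps).real ({ω : (r : Fin (n + 2)) → Ωs r |
        ((∑ j, S j k (ω j) / V j k (ω j)) / (∑ j, (V j k (ω j))⁻¹) - a) ^ 2 * (∑ j, (V j k (ω j))⁻¹)
          ≤ z ^ 2} ∩ {ω | ∑ r, (S r k (ω r) - (∑ j, S j k (ω j) / V j k (ω j)) / (∑ j, (V j k (ω j))⁻¹)) ^ 2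
          / V r k (ω r) ≤ c})
        / (Measure.pi Ps).real {ω : (r : Fin (n + 2)) → Ωs r |
          ∑ r, (S r k (ω r) - (∑ j, S j k (ω j) / V j k (ω j)) / (∑ j, (V j k (ω j))⁻¹)) ^ 2
            / V r k (ω r) ≤ c})
      atTop (𝓝 ((gaussianReal ((∑ j, h j / s j) / (∑ j, (s j)⁻¹) * Real.sqrt (∑ j, (s j)⁻¹)) 1).real
        (Icc (-|z|) |z|))) := by
  have hjoint := kArm_pooled_homogeneity_localDrift hs hSm hVm hclt hZm hZ hind hV z c
  have htest := kArm_homogeneity_localPower hs hSm hVm hclt hZm hZ hind hV c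
  have hpos := pi_gaussianReal_shiftedBall_pos (ι := Fin (n + 2)) 0 1
    (Real.sqrt (∑ r, (h r - (∑ j, h j / s j) / (∑ j, (s j)⁻¹)) ^ 2 / s r)) hc
  have hdiv := hjoint.div htest hpos.ne'
  rw [mul_div_cancel_right₀ _ hpos.ne'] at hdiv
  exact hdiv

end Drift

/-! ## §3 A drift common to all codes: invisible to the test, fully present in the pooled interval -/

section CommonDrift

variable {n : ℕ} {Ωs : Fin (n + 2) → Type*} [∀ r, MeasurableSpace (Ωs r)]
  {Ps : (r : Fin (n + 2)) → Measure (Ωs r)} [∀ r, IsProbabilityMeasure (Ps r)]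
variable {Ω' : Type*} [MeasurableSpace Ω'] {P' : Measure Ω'} [IsProbabilityMeasure P']

/-- **UNDER A COMMON DRIFT `d` THE POOLED INTERVAL COVERS THE NOMINAL TARGET WITH PROBABILITY
`→ N(d·√W, 1)([−|z|,|z|])`**, `W = Σ_r s_r⁻¹` (while the homogeneity test is nominal,
`Scoring/KArmHomogeneityLocalPowerStrict.kArm_homogeneity_localPower_of_common_drift`). [ours] -/
theorem kArm_pooled_commonDrift {S V : (r : Fin (n + 2)) → ℕ → Ωs r → ℝ} {a : ℝ}
    {h s : Fin (n + 2) → ℝ} {Z : Fin (n + 2) → Ω' → ℝ} (hs : ∀ r, 0 < s r)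
    (hSm : ∀ r k, Measurable (S r k)) (hVm : ∀ r k, Measurable (V r k))
    (hclt : ∀ r, TendstoInDistribution (fun (k : ℕ) ω => Real.sqrt k * (S r k ω - a)) atTop (Z r)
      (fun _ => Ps r) P')
    (hZm : ∀ r, Measurable (Z r)) (hZ : ∀ r, HasLaw (Z r) (gaussianReal (h r) (s r).toNNReal) P')
    (hind : iIndepFun Z P')
    (hV : ∀ r, ∀ᵐ ω ∂(Ps r), Tendsto (fun k : ℕ => (k : ℝ) * V r k ω) atTop (𝓝 (s r)))
    {d : ℝ} (hh : ∀ r, h r = d) (z : ℝ) :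
    Tendsto (fun k : ℕ => (Measure.pi Ps).real {ω : (r : Fin (n + 2)) → Ωs r |
        ((∑ j, S j k (ω j) / V j k (ω j)) / (∑ j, (V j k (ω j))⁻¹) - a) ^ 2 * (∑ j, (V j k (ω j))⁻¹)
          ≤ z ^ 2})
      atTop (𝓝 ((gaussianReal (d * Real.sqrt (∑ j, (s j)⁻¹)) 1).real (Icc (-|z|) |z|))) := by
  have hW : (∑ j, (s j)⁻¹) ≠ 0 :=
    (Finset.sum_pos (fun j _ => inv_pos.2 (hs j)) Finset.univ_nonempty).ne'
  have hmean : (∑ j, h j / s j) / (∑ j, (s j)⁻¹) = d := by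
    rw [div_eq_iff hW, Finset.mul_sum]
    refine Finset.sum_congr rfl fun j _ => ?_
    rw [hh j, div_eq_mul_inv]
  have h1 := kArm_pooled_localDrift hs hSm hVm hclt hZm hZ hind hV z
  rw [hmean] at h1
  exact h1

/-- **… which is STRICTLY BELOW THE NOMINAL probability** for `d ≠ 0`, `z ≠ 0`, `W > 0`:
`N(d·√W, 1)([−|z|,|z|]) < N(0,1)([−|z|,|z|])`. [ours] -/
theorem gaussianReal_real_Icc_symm_drift_lt {d W z : ℝ} (hd : d ≠ 0) (hW : 0 < W) (hz : z ≠ 0) :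
    (gaussianReal (d * Real.sqrt W) 1).real (Icc (-|z|) |z|)
      < (gaussianReal 0 1).real (Icc (-|z|) |z|) := by
  have hz' : 0 < |z| := abs_pos.2 hz
  have hanti := strictAntiOn_gaussianReal_real_Icc_symm hz'
  have hne : d * Real.sqrt W ≠ 0 := mul_ne_zero hd (Real.sqrt_pos.2 hW).ne'
  rcases lt_or_gt_of_ne hne with hneg | hpos
  · rw [← gaussianReal_real_Icc_symm_neg (d * Real.sqrt W) |z|]
    exact hanti (Set.mem_Ici.2 le_rfl) (Set.mem_Ici.2 (neg_pos.2 hneg).le) (neg_pos.2 hneg)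
  · exact hanti (Set.mem_Ici.2 le_rfl) (Set.mem_Ici.2 hpos.le) hpos

/-- **… and STRICTLY DECREASING IN THE POOLED PRECISION `W`** (`d ≠ 0`, `z ≠ 0`): pooling more, or
more precise, equally-biased codes makes the pooled interval miss the nominal target more often. [ours] -/
theorem gaussianReal_real_Icc_symm_drift_strictAnti {d z : ℝ} (hd : d ≠ 0) (hz : z ≠ 0) :
    StrictAntiOn (fun W : ℝ => (gaussianReal (d * Real.sqrt W) 1).real (Icc (-|z|) |z|)) (Ioi 0) := by
  have hz' : 0 < |z| := abs_pos.2 hz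
  have hanti := strictAntiOn_gaussianReal_real_Icc_symm hz'
  have key : ∀ W : ℝ, (gaussianReal (d * Real.sqrt W) 1).real (Icc (-|z|) |z|)
      = (gaussianReal (|d| * Real.sqrt W) 1).real (Icc (-|z|) |z|) := by
    intro W
    rcases le_or_gt 0 d with hd0 | hd0
    · rw [abs_of_nonneg hd0]
    · rw [abs_of_neg hd0, neg_mul, gaussianReal_real_Icc_symm_neg]
  intro W hW W' hW' hlt
  simp only [key]
  have hd' : 0 < |d| := abs_pos.2 hd
  have h1 : |d| * Real.sqrt W < |d| * Real.sqrt W' :=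
    mul_lt_mul_of_pos_left (Real.sqrt_lt_sqrt (le_of_lt hW) hlt) hd'
  exact hanti (Set.mem_Ici.2 (by positivity)) (Set.mem_Ici.2 (by positivity)) h1

end CommonDrift

end Summit.Ventures.LatticeQCDFlow.Scoring
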